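import Summits.HodgeConjecture.HodgeConjecture.Theorems.F0P6aModuliDatumDefs
import Literature.AlgebraicGeometry.AbelianSchemes.AbelianSchemeFibreFrobeniusTwistPolarization
import Literature.AlgebraicGeometry.Motives.GaloisThickeningMovedSheetFrobenius
import Literature.AlgebraicGeometry.AbelianSchemes.SerrePresentationOfKernelLaw
import Literature.AlgebraicGeometry.AbelianSchemes.SerreTensorBaseChange
import Literature.AlgebraicGeometry.AbelianSchemes.CoverFiniteFlatOfSerrePresentation
import Literature.NumberTheory.NumberFields.CMTwistNormCoprimeLevel
import Literature.NumberTheory.NumberFields.CMTwistNormGlueRows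
import Literature.NumberTheory.NumberFields.SerreTensorPresentationOfIdeal
import Summits.HodgeConjecture.HodgeConjecture.Theorems.F0P6aRGDAssemblyDefs
import Literature.AlgebraicGeometry.AbelianSchemes.AbelianSchemeHomReductionSpecialFibreKernel
import Literature.AlgebraicGeometry.AbelianSchemes.RoofLegsSpecialFibre
import HarnessLib

/-!
# `F0P6aStubFROBCoverTailBridge` — the (ν8k) ⇄ D-line CURRENCY BRIDGE for ★ `Theorems/F0P6aStubFROBCoverTail.lean` :313 `reductionRows_of_coverRows`

Cell `hodgecm-mathlib`, F0∕P6 half A line L3 (socket `stub_FROB`, organ `stub_COV0`, road (δ)); «M-138b» daylight debt row `CoverTail :313` (the last L3 budget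
outlier: `set_option maxHeartbeats 800000 in`, measured 444 706); dealer «L3» LA3-plan (g7) DEAL L3-D6 (2026-09-03T07:31Z); hand LA3-p02 (g9).  THEOREMS ONLY
(two), sorry-free, no definition, no instance, no notation; imports = ★ `F0P6aStubFROBCoverTail`'s own imports (NOT that module), same namespace
`…Cruxes.HLiu418.F0P6aStubFROBCover` (namespaces are open; no name of that module is redeclared).

WHY.  The closer `reductionRows_of_coverRows` reads ★ (ν8k) ED. 2 `exists_specialFibre_hom_reduction_ker_ringAction` (p849382) — stated in the ★ currency
`((𝒜.baseChange ι).baseChange x.left).X` over `(specOver _ _).left`, `T : Over (Spec _)`, `((act.baseChange ι).baseChange x.left).i a`, `restrictPt _ (sectionBaseChange _ τ)`,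
`𝓨.geomReductionMap x` — against a statement written in the D-line currency of `Theorems/F0P6aModuliDatumDefs*` (`schΩOf`∕`sch₀Of` over `Spec (.of _)`, `T : SchemeOver _`,
`actΩOf`∕`act₀Of`, `lvlPtΩOf`∕`lvlPt₀Of`, `red₀Of`).  The two spellings are definitionally equal but NOT syntactically equal (the differences sit at the base object
`(specOver _ _).left` vs `Spec (.of _)` — a `δ` through `Over.mk` — inside thousands of instance arguments of ≈ 3·10⁶-node types; HOME probes of LA3-p02 (g8)∕(g9),
LA3-p01 (g7): `obtain` 106 k + `refine` 129 k + closings 115 k, no proof-local rewiring cuts it, `with_reducible` fails, `simp`∕`dsimp` normal forms do not reach the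
instance positions).  This file pays that conversion ONCE, split over two theorems each under the default-size budget discipline (≤ 400 k):
* `reductionRowsStar_of_coverRows` — the D-line HYPOTHESES of :313 (verbatim) ⟹ the five downstairs rows the closer consumes ((i) surjectivity, (v′) ideal kernel,
  (iv) polarisation law at `(I.dual, I.pol)`, (ii-ι) `𝒪_F`-equivariance, (iii) level sections), packaged as ONE `∃ ū` statement IN THE ★ CURRENCY (token for token
  the instantiation of ★ (ν8k) ED. 2 at `𝓨 := 𝓜.localise w`, `x := thickeningLift e₁ _ y₁`, `x″ := thickeningLift e₂ _ y₁`, `𝒜 = 𝒞 := I.univ`, `act = act″ := I.act`,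
  the `IsProper` instance being `h𝓨.2` EXPLICITLY — LA2-p04 (g8)'s instance-position finding);
* `reductionRows_of_reductionRowsStar` — that ★-currency package ⟹ the CONCLUSION of :313 verbatim (D-line currency).
The closer then becomes the composition of the two (edition v3 of ★ `F0P6aStubFROBCoverTail`, statement byte-identical), and its 800 k line goes.
It asserts nothing new: both theorems are definitional re-spellings of ★ (ν8k) ED. 2 at the D-line's carriers.
HC_CM is proved only modulo the 7 printed citations (2 remaining: hLiu418 = stmt-HodgeConjecture-24832, h413 = stmt-HodgeConjecture-24833) until rung 0 closes; count-neutral.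
-/

set_option autoImplicit false
set_option linter.dupNamespace false

noncomputable section

namespace Summit.HodgeConjecture.HodgeConjecture.Cruxes.HLiu418.F0P6aStubFROBCover

open CategoryTheory CategoryTheory.Limits AlgebraicGeometry NumberField IsDedekindDomain
open scoped MonObj CategoryTheory.Obj Matrix
open Literature.AlgebraicGeometry.Motives (AlgPoints IntegralModel SchemeOver frobeniusOver relFrobeniusOver frobSpec)
open Literature.NumberTheory.DiophantineGeometry (geomResidueField specResidueField)
open Literature.AlgebraicGeometry.AbelianSchemes Literature.AlgebraicGeometry.AbelianSchemes.AbelianSchemeOver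
open Summit.HodgeConjecture.HodgeConjecture.Cruxes.HLiu418.F0P6aModuliDatumDefs
open Literature.NumberTheory.GaloisRepresentations
open Literature.NumberTheory.Automorphic Literature.NumberTheory.Automorphic.UnitaryGroup
open Literature.AlgebraicGeometry.ShimuraVarieties.UnitaryCanonicalModel
open Literature.NumberTheory.Automorphic.Liu2021.AppendixC
open Literature.AlgebraicGeometry.Motives (thickening thickeningLift)

/-! ## The bridge (section context = ★ `F0P6aStubFROBCoverTail` §5 `CloserDelta`, minus its three unused instance binders) -/
section Bridge

variable {F : Type} [Field F] [NumberField F] [IsCMField F] [IsGalois ℚ F] {ι₁ : F →+* ℂ}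
    {Jstar : Matrix (Fin 2) (Fin 2) F}
    {K₀ : C5.OpenCompactSubgroup ↥(finAdelic ↥(maximalRealSubfield F) F (IsCMField.complexConj F) 2 Jstar)}
    {S : RecordSystemGS F Jstar ι₁ K₀} {hU7ₛ : S.HeckeTranslateDefinedOver}
    {hJ : (Jstar.map (IsCMField.complexConj F))ᵀ = Jstar} {hJu : IsUnit Jstar}
    {Fi : Type} [Field Fi] [Algebra F Fi] {Kc : C5.SmallLevel K₀} {G : Type} [Group G]
    {𝓜 : IntegralModel (𝓞 F) F ((thickening F Fi).obj (S.M.obj Kc))}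
    {w : HeightOneSpectrum (𝓞 F)} {hw : (IsCMField.complexConj F) • w ≠ w} {h𝓨 : (𝓜.localise w).IsSmoothProper 1}
    {θ : Literature.AlgebraicGeometry.RelativeSpec.ActionOver (𝓜.localise w).total.hom ((Fi ≃ₐ[F] Fi) × G)}
    {e : Fi →ₐ[F] AlgebraicClosure (w.adicCompletion F)}

open Summit.HodgeConjecture.HodgeConjecture.Cruxes.HLiu418.F0P6aRGDAssembly in
-- as ★ (ν8k)՚s own file (file-wide there): the ★ currency types `T : Over (Spec _)` against objects over `(specOver _ _).left`, whose hom-monoid `1` is found only above `instances` transparency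
set_option backward.isDefEq.respectTransparency false in
set_option maxHeartbeats 400000 in
/-- **UPSTAIRS HALF OF THE BRIDGE: the D-line hypotheses of the closer ⟹ the five downstairs rows of ★ (ν8k) ED. 2, IN THE ★ CURRENCY.**  Binders = those of
★ `reductionRows_of_coverRows` verbatim (sheets `e₁ e₂`, record point `y₁`, ideal `𝔞` with Serre presentation `(E′, P, Q, N)`, `n`, a finite surjective homomorphism
`u` between the sheet fibres `schΩOf … e₁ ∕ e₂ … y₁` with kernel `A[𝔞]` on all `T`-points (`hK`), rows (t3) `h3`, (t4) `h4`, (t5) `h5`); conclusion = `∃ ū` with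
(i) `ū` surjective, (v′) `Ker ū = A_{x̄₁}[𝔞]` on all `T`-points, (iv) the polarisation law at `(I.dual, I.pol)`, (ii-ι) `𝒪_F`-equivariance, (iii) the level sections —
spelled EXACTLY as ★ `exists_specialFibre_hom_reduction_ker_ringAction` instantiates them at `𝓨 := 𝓜.localise w` (instance `IsProper` := `h𝓨.2`, explicit),
`𝒜 = 𝒞 := I.univ`, `act = act″ := I.act`, `x := thickeningLift e₁ (S.M.obj Kc) y₁`, `x″ := thickeningLift e₂ (S.M.obj Kc) y₁`.  Proof: the tree's three upstairs
currency rewrites (`actΩOf` ↦ `((act.baseChange _).baseChange _).i a` by ★ `fibreHom_hom_hom_hom` ∕ ★ `RingAction.baseChange_i`; `lvlPtΩOf` ↦ `restrictPt _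
(sectionBaseChange _ (section_ a))` by ★ `LevelStructure.baseChange_section_`), then ★ (ν8k) ED. 2 applied once.
[cite: SerreTate1968, §1 Lemma 2, Thm 1] [cite: MumfordAV1970, §7 Thm. 4 (p. 72), §15 Thm. 1 (p. 143)] [cite: BoschLutkebohmertRaynaud1990, §7.3 Prop. 6 (p. 180)] -/
theorem reductionRowsStar_of_coverRows (I : RGDInputsAt F ι₁ Jstar K₀ S hU7ₛ hJ hJu Fi Kc G 𝓜 w hw h𝓨 θ e)
    (e₁ e₂ : Fi →ₐ[F] AlgebraicClosure (w.adicCompletion F)) (y₁ : AlgPoints (S.M.obj Kc) (AlgebraicClosure (w.adicCompletion F)))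
    (𝔞 : Ideal (𝓞 F)) (n : ℕ) {m : ℕ} (E' : Matrix (Fin m) (Fin m) (𝓞 F)) (hE' : E' * E' = E') (P : Matrix (Fin m) (Fin 1) (𝓞 F))
    (Q : Matrix (Fin 1) (Fin m) (𝓞 F)) {N : ℕ} (hN : N ≠ 0) (hP : E' * P = P) (hQ : Q * E' = Q) (hQP : Q * P = Matrix.scalar (Fin 1) (N : 𝓞 F))
    (hPQ : P * Q = Matrix.scalar (Fin m) (N : 𝓞 F) * E') (h𝔞 : Ideal.span (Set.range fun k => P k 0) = 𝔞)
    (u : (schΩOf S Kc 𝓜 w e₁ I.univ y₁).X ⟶ (schΩOf S Kc 𝓜 w e₂ I.univ y₁).X) [IsMonHom u] (hfin : IsFinite u.left) (hsurj : Surjective u.left)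
    (hK : ∀ ⦃T : SchemeOver (AlgebraicClosure (w.adicCompletion F))⦄ (t : T ⟶ (schΩOf S Kc 𝓜 w e₁ I.univ y₁).X),
        t ≫ u = 1 ↔ ∀ a ∈ 𝔞, t ≫ (actΩOf S Kc 𝓜 w e₁ I.univ I.act a y₁).hom.hom.hom = 1)
    (h3 : u ≫ (polΩOf S Kc 𝓜 w e₂ I.univ I.pol y₁).lam ≫
        Literature.AlgebraicGeometry.AbelianSchemes.AbelianSchemeOver.DualPair.dualIsogenyOver u
          (dualΩOf S Kc 𝓜 w e₁ I.univ I.dual y₁) (dualΩOf S Kc 𝓜 w e₂ I.univ I.dual y₁) =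
      (polΩOf S Kc 𝓜 w e₁ I.univ I.pol y₁).lam ≫ (dualΩOf S Kc 𝓜 w e₁ I.univ I.dual y₁).hat.mulN n)
    (h4 : ∀ a : 𝓞 F, (actΩOf S Kc 𝓜 w e₁ I.univ I.act a y₁).hom.hom.hom ≫ u = u ≫ (actΩOf S Kc 𝓜 w e₂ I.univ I.act a y₁).hom.hom.hom)
    (h5 : ∀ a : Fin I.g ⊕ Fin I.g → ZMod I.N,
        (AlgPoints.map u (lvlPtΩOf S Kc 𝓜 w e₁ I.univ I.lvl y₁ a) :
            (fibreΩOf S Kc 𝓜 w e₂ I.univ y₁).Points (AlgebraicClosure (w.adicCompletion F))) = lvlPtΩOf S Kc 𝓜 w e₂ I.univ I.lvl y₁ a) :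
    haveI : IsProper (𝓜.localise w).total.hom := h𝓨.2
    ∃ (ubar : ((I.univ.baseChange (pullback.fst (𝓜.localise w).total.hom (specResidueField w))).baseChange
                  ((𝓜.localise w).geomReductionMap (thickeningLift e₁ (S.M.obj Kc) y₁)).left).X ⟶
               ((I.univ.baseChange (pullback.fst (𝓜.localise w).total.hom (specResidueField w))).baseChange
                  ((𝓜.localise w).geomReductionMap (thickeningLift e₂ (S.M.obj Kc) y₁)).left).X) (_ : IsMonHom ubar),
      Function.Surjective ubar.left.base ∧
      (∀ ⦃T : Over (Spec (.of (geomResidueField w)))⦄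
          (t : T ⟶ ((I.univ.baseChange (pullback.fst (𝓜.localise w).total.hom (specResidueField w))).baseChange
              ((𝓜.localise w).geomReductionMap (thickeningLift e₁ (S.M.obj Kc) y₁)).left).X),
        t ≫ ubar = 1 ↔ ∀ a ∈ 𝔞,
          t ≫ ((I.act.baseChange (pullback.fst (𝓜.localise w).total.hom (specResidueField w))).baseChange
              ((𝓜.localise w).geomReductionMap (thickeningLift e₁ (S.M.obj Kc) y₁)).left).i a = 1) ∧
      ubar ≫ ((I.pol.baseChange (pullback.fst (𝓜.localise w).total.hom (specResidueField w))).baseChange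
            ((𝓜.localise w).geomReductionMap (thickeningLift e₂ (S.M.obj Kc) y₁)).left).lam ≫
          DualPair.dualIsogenyOver ubar
            ((I.dual.baseChange (pullback.fst (𝓜.localise w).total.hom (specResidueField w))).baseChange
              ((𝓜.localise w).geomReductionMap (thickeningLift e₁ (S.M.obj Kc) y₁)).left)
            ((I.dual.baseChange (pullback.fst (𝓜.localise w).total.hom (specResidueField w))).baseChange
              ((𝓜.localise w).geomReductionMap (thickeningLift e₂ (S.M.obj Kc) y₁)).left) =
        ((I.pol.baseChange (pullback.fst (𝓜.localise w).total.hom (specResidueField w))).baseChange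
            ((𝓜.localise w).geomReductionMap (thickeningLift e₁ (S.M.obj Kc) y₁)).left).lam ≫
          ((I.dual.baseChange (pullback.fst (𝓜.localise w).total.hom (specResidueField w))).baseChange
            ((𝓜.localise w).geomReductionMap (thickeningLift e₁ (S.M.obj Kc) y₁)).left).hat.mulN n ∧
      (∀ a : 𝓞 F,
        ((I.act.baseChange (pullback.fst (𝓜.localise w).total.hom (specResidueField w))).baseChange
            ((𝓜.localise w).geomReductionMap (thickeningLift e₁ (S.M.obj Kc) y₁)).left).i a ≫ ubar =
          ubar ≫ ((I.act.baseChange (pullback.fst (𝓜.localise w).total.hom (specResidueField w))).baseChange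
            ((𝓜.localise w).geomReductionMap (thickeningLift e₂ (S.M.obj Kc) y₁)).left).i a) ∧
      (∀ a : Fin I.g ⊕ Fin I.g → ZMod I.N,
        AlgPoints.map ubar
            ((I.univ.baseChange (pullback.fst (𝓜.localise w).total.hom (specResidueField w))).restrictPt
              ((𝓜.localise w).geomReductionMap (thickeningLift e₁ (S.M.obj Kc) y₁)).left
              (I.univ.sectionBaseChange (pullback.fst (𝓜.localise w).total.hom (specResidueField w)) (I.lvl.section_ a))) =
          (I.univ.baseChange (pullback.fst (𝓜.localise w).total.hom (specResidueField w))).restrictPt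
            ((𝓜.localise w).geomReductionMap (thickeningLift e₂ (S.M.obj Kc) y₁)).left
            (I.univ.sectionBaseChange (pullback.fst (𝓜.localise w).total.hom (specResidueField w)) (I.lvl.section_ a))) := by
  haveI : IsCommMonObj I.univ.X := I.comm
  -- upstairs currency: REWRITE the Defs readings into ★ (ν8k)'s `((act.baseChange _).baseChange _).i a` ∕ `sectionBaseChange` shape (the tree's three rewrites, verbatim)
  have hK' : ∀ ⦃T : SchemeOver (AlgebraicClosure (w.adicCompletion F))⦄ (t : T ⟶ (schΩOf S Kc 𝓜 w e₁ I.univ y₁).X),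
      t ≫ u = 1 ↔ ∀ a ∈ 𝔞,
        t ≫ ((I.act.baseChange ((𝓜.localise w).genericIso'.inv.left ≫ pullback.fst (𝓜.localise w).total.hom
          (Literature.NumberTheory.EllipticCurves.specGenericPoint (HeightOneSpectrum.valuationSubringAtPrime F w) F))).baseChange (thickeningLift e₁ (S.M.obj Kc) y₁).left).i a = (1 : T ⟶ (schΩOf S Kc 𝓜 w e₁ I.univ y₁).X) := by
    intro T t
    have := hK t
    simp only [actΩOf, AbelianSchemeOver.fibreHom_hom_hom_hom, RingAction.baseChange_i, AbelianSchemeOver.baseChangeHom] at this ⊢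
    exact this
  have h4'' : ∀ a : 𝓞 F,
      ((I.act.baseChange ((𝓜.localise w).genericIso'.inv.left ≫ pullback.fst (𝓜.localise w).total.hom
          (Literature.NumberTheory.EllipticCurves.specGenericPoint (HeightOneSpectrum.valuationSubringAtPrime F w) F))).baseChange (thickeningLift e₁ (S.M.obj Kc) y₁).left).i a ≫ u =
        u ≫ ((I.act.baseChange ((𝓜.localise w).genericIso'.inv.left ≫ pullback.fst (𝓜.localise w).total.hom
          (Literature.NumberTheory.EllipticCurves.specGenericPoint (HeightOneSpectrum.valuationSubringAtPrime F w) F))).baseChange (thickeningLift e₂ (S.M.obj Kc) y₁).left).i a := fun a => by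
    have := h4 a
    simp only [actΩOf, AbelianSchemeOver.fibreHom_hom_hom_hom, RingAction.baseChange_i, AbelianSchemeOver.baseChangeHom] at this ⊢
    exact this
  have h5' : ∀ a : Fin I.g ⊕ Fin I.g → ZMod I.N,
      AlgPoints.map u ((I.univ.baseChange ((𝓜.localise w).genericIso'.inv.left ≫ pullback.fst (𝓜.localise w).total.hom
          (Literature.NumberTheory.EllipticCurves.specGenericPoint (HeightOneSpectrum.valuationSubringAtPrime F w) F))).restrictPt (thickeningLift e₁ (S.M.obj Kc) y₁).left (I.univ.sectionBaseChange _ (I.lvl.section_ a))) =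
        (I.univ.baseChange ((𝓜.localise w).genericIso'.inv.left ≫ pullback.fst (𝓜.localise w).total.hom
          (Literature.NumberTheory.EllipticCurves.specGenericPoint (HeightOneSpectrum.valuationSubringAtPrime F w) F))).restrictPt (thickeningLift e₂ (S.M.obj Kc) y₁).left (I.univ.sectionBaseChange _ (I.lvl.section_ a)) := fun a => by
    have := h5 a
    simp only [lvlPtΩOf, LevelStructure.baseChange_section_] at this
    exact this
  -- ★ (ν8k) ED. 2 p849382 APPLIED ONCE — the `IsProper` instance passed EXPLICITLY as `h𝓨.2` (so the outputs spell the statement's `haveI` token for token), `act″ := I.act`;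
  -- as a `have` FIRST (the application elaborates against no expected type: 35 k), destructured AFTER (5 k) — `obtain ⟨…⟩ := <the application>` in one step costs 30× more here
  have h8 :=
    @exists_specialFibre_hom_reduction_ker_ringAction F _ _ w _ (𝓜.localise w) h𝓨.2 I.univ I.univ (thickeningLift e₁ (S.M.obj Kc) y₁)
      (thickeningLift e₂ (S.M.obj Kc) y₁) u ‹IsMonHom u› (𝓞 F) _ I.act I.act I.comm _ E' hE' P Q _ hN hP hQ hQP hPQ _ h𝔞 hK'
  obtain ⟨ubar, hmon, hi, hii, hiiι, hiii, hiv, hv⟩ := h8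
  exact ⟨ubar, hmon, (hi hfin hsurj).2, hv hfin hsurj, hiv I.dual I.pol I.dual I.pol _ h3, fun a => hiiι a (h4'' a),
    fun a => hiii (I.lvl.section_ a) (I.lvl.section_ a) (h5' a)⟩

open Summit.HodgeConjecture.HodgeConjecture.Cruxes.HLiu418.F0P6aRGDAssembly in
-- as ★ (ν8k)՚s own file (file-wide there): the ★ currency types `T : Over (Spec _)` against objects over `(specOver _ _).left`, whose hom-monoid `1` is found only above `instances` transparency
set_option backward.isDefEq.respectTransparency false in
set_option maxHeartbeats 400000 in
/-- **DOWNSTAIRS HALF OF THE BRIDGE: the five ★-currency rows ⟹ the conclusion of the closer VERBATIM (D-line currency).**  Hypothesis `h` = the conclusion of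
`reductionRowsStar_of_coverRows` token for token; conclusion = the conclusion of ★ `reductionRows_of_coverRows` token for token (`sch₀Of`∕`red₀Of`∕`act₀Of`∕`pol₀Of`∕
`dual₀Of`∕`lvlPt₀Of`, `T : SchemeOver κ̄(w)`).  Proof: unpack, repack; the three readings that are `def`s downstairs (`act₀Of` twice, `lvlPt₀Of`) are rewritten to the ★
spelling by ★ `fibreHom_hom_hom_hom` ∕ ★ `RingAction.baseChange_i` ∕ ★ `LevelStructure.baseChange_section_` exactly as in the tree; everything else is the abbrevs'
definitional unfolding, paid here once.
[cite: SerreTate1968, §1 Lemma 2, Thm 1] [cite: MumfordFogartyKirwan1994, Ch. 6 §1 Corollary 6.2 (p. 116); Ch. 7 §2 Definition 7.2 (p. 129)] -/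
theorem reductionRows_of_reductionRowsStar (I : RGDInputsAt F ι₁ Jstar K₀ S hU7ₛ hJ hJu Fi Kc G 𝓜 w hw h𝓨 θ e)
    (e₁ e₂ : Fi →ₐ[F] AlgebraicClosure (w.adicCompletion F)) (y₁ : AlgPoints (S.M.obj Kc) (AlgebraicClosure (w.adicCompletion F)))
    (𝔞 : Ideal (𝓞 F)) (n : ℕ)
    (h : haveI : IsProper (𝓜.localise w).total.hom := h𝓨.2
      ∃ (ubar : ((I.univ.baseChange (pullback.fst (𝓜.localise w).total.hom (specResidueField w))).baseChange
                    ((𝓜.localise w).geomReductionMap (thickeningLift e₁ (S.M.obj Kc) y₁)).left).X ⟶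
                 ((I.univ.baseChange (pullback.fst (𝓜.localise w).total.hom (specResidueField w))).baseChange
                    ((𝓜.localise w).geomReductionMap (thickeningLift e₂ (S.M.obj Kc) y₁)).left).X) (_ : IsMonHom ubar),
        Function.Surjective ubar.left.base ∧
        (∀ ⦃T : Over (Spec (.of (geomResidueField w)))⦄
            (t : T ⟶ ((I.univ.baseChange (pullback.fst (𝓜.localise w).total.hom (specResidueField w))).baseChange
                ((𝓜.localise w).geomReductionMap (thickeningLift e₁ (S.M.obj Kc) y₁)).left).X),
          t ≫ ubar = 1 ↔ ∀ a ∈ 𝔞,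
            t ≫ ((I.act.baseChange (pullback.fst (𝓜.localise w).total.hom (specResidueField w))).baseChange
                ((𝓜.localise w).geomReductionMap (thickeningLift e₁ (S.M.obj Kc) y₁)).left).i a = 1) ∧
        ubar ≫ ((I.pol.baseChange (pullback.fst (𝓜.localise w).total.hom (specResidueField w))).baseChange
              ((𝓜.localise w).geomReductionMap (thickeningLift e₂ (S.M.obj Kc) y₁)).left).lam ≫
            DualPair.dualIsogenyOver ubar
              ((I.dual.baseChange (pullback.fst (𝓜.localise w).total.hom (specResidueField w))).baseChange
                ((𝓜.localise w).geomReductionMap (thickeningLift e₁ (S.M.obj Kc) y₁)).left)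
              ((I.dual.baseChange (pullback.fst (𝓜.localise w).total.hom (specResidueField w))).baseChange
                ((𝓜.localise w).geomReductionMap (thickeningLift e₂ (S.M.obj Kc) y₁)).left) =
          ((I.pol.baseChange (pullback.fst (𝓜.localise w).total.hom (specResidueField w))).baseChange
              ((𝓜.localise w).geomReductionMap (thickeningLift e₁ (S.M.obj Kc) y₁)).left).lam ≫
            ((I.dual.baseChange (pullback.fst (𝓜.localise w).total.hom (specResidueField w))).baseChange
              ((𝓜.localise w).geomReductionMap (thickeningLift e₁ (S.M.obj Kc) y₁)).left).hat.mulN n ∧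
        (∀ a : 𝓞 F,
          ((I.act.baseChange (pullback.fst (𝓜.localise w).total.hom (specResidueField w))).baseChange
              ((𝓜.localise w).geomReductionMap (thickeningLift e₁ (S.M.obj Kc) y₁)).left).i a ≫ ubar =
            ubar ≫ ((I.act.baseChange (pullback.fst (𝓜.localise w).total.hom (specResidueField w))).baseChange
              ((𝓜.localise w).geomReductionMap (thickeningLift e₂ (S.M.obj Kc) y₁)).left).i a) ∧
        (∀ a : Fin I.g ⊕ Fin I.g → ZMod I.N,
          AlgPoints.map ubar
              ((I.univ.baseChange (pullback.fst (𝓜.localise w).total.hom (specResidueField w))).restrictPt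
                ((𝓜.localise w).geomReductionMap (thickeningLift e₁ (S.M.obj Kc) y₁)).left
                (I.univ.sectionBaseChange (pullback.fst (𝓜.localise w).total.hom (specResidueField w)) (I.lvl.section_ a))) =
            (I.univ.baseChange (pullback.fst (𝓜.localise w).total.hom (specResidueField w))).restrictPt
              ((𝓜.localise w).geomReductionMap (thickeningLift e₂ (S.M.obj Kc) y₁)).left
              (I.univ.sectionBaseChange (pullback.fst (𝓜.localise w).total.hom (specResidueField w)) (I.lvl.section_ a)))) :
    ∃ (ubar : (sch₀Of 𝓜 w I.univ (red₀Of S Kc 𝓜 w h𝓨 e₁ y₁)).X ⟶ (sch₀Of 𝓜 w I.univ (red₀Of S Kc 𝓜 w h𝓨 e₂ y₁)).X) (_ : IsMonHom ubar),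
      Function.Surjective ubar.left.base ∧
      (∀ ⦃T : SchemeOver (geomResidueField w)⦄ (t : T ⟶ (sch₀Of 𝓜 w I.univ (red₀Of S Kc 𝓜 w h𝓨 e₁ y₁)).X),
          t ≫ ubar = 1 ↔ ∀ a ∈ 𝔞, t ≫ (act₀Of 𝓜 w I.univ I.act a (red₀Of S Kc 𝓜 w h𝓨 e₁ y₁)).hom.hom.hom = 1) ∧
      ubar ≫ (pol₀Of 𝓜 w I.univ I.pol (red₀Of S Kc 𝓜 w h𝓨 e₂ y₁)).lam ≫
          Literature.AlgebraicGeometry.AbelianSchemes.AbelianSchemeOver.DualPair.dualIsogenyOver ubar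
            (dual₀Of 𝓜 w I.univ I.dual (red₀Of S Kc 𝓜 w h𝓨 e₁ y₁)) (dual₀Of 𝓜 w I.univ I.dual (red₀Of S Kc 𝓜 w h𝓨 e₂ y₁)) =
        (pol₀Of 𝓜 w I.univ I.pol (red₀Of S Kc 𝓜 w h𝓨 e₁ y₁)).lam ≫ (dual₀Of 𝓜 w I.univ I.dual (red₀Of S Kc 𝓜 w h𝓨 e₁ y₁)).hat.mulN n ∧
      (∀ a : 𝓞 F, (act₀Of 𝓜 w I.univ I.act a (red₀Of S Kc 𝓜 w h𝓨 e₁ y₁)).hom.hom.hom ≫ ubar =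
          ubar ≫ (act₀Of 𝓜 w I.univ I.act a (red₀Of S Kc 𝓜 w h𝓨 e₂ y₁)).hom.hom.hom) ∧
      (∀ a : Fin I.g ⊕ Fin I.g → ZMod I.N,
          AlgPoints.map ubar (lvlPt₀Of 𝓜 w I.univ I.lvl (red₀Of S Kc 𝓜 w h𝓨 e₁ y₁) a) =
            lvlPt₀Of 𝓜 w I.univ I.lvl (red₀Of S Kc 𝓜 w h𝓨 e₂ y₁) a) := by
  obtain ⟨ubar, hmon, hi, hv, hiv, hii, hiii⟩ := h
  haveI := hmon
  refine ⟨ubar, hmon, hi, fun T t => ?_, hiv, fun a => ?_, fun a => ?_⟩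
  · -- (f1′): the D-line reading `act₀Of` rewritten to the ★ spelling, as in the tree
    have := hv t
    simp only [act₀Of, AbelianSchemeOver.fibreHom_hom_hom_hom, RingAction.baseChange_i, AbelianSchemeOver.baseChangeHom] at this ⊢
    exact this
  · -- (f4)
    have := hii a
    simp only [act₀Of, AbelianSchemeOver.fibreHom_hom_hom_hom, RingAction.baseChange_i, AbelianSchemeOver.baseChangeHom] at this ⊢
    exact this
  · -- (f5)
    have := hiii a
    simp only [lvlPt₀Of, LevelStructure.baseChange_section_]
    exact this

end Bridge

end Summit.HodgeConjecture.HodgeConjecture.Cruxes.HLiu418.F0P6aStubFROBCover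

end
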